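import Mathlib.Analysis.SpecialFunctions.ImproperIntegrals
import Mathlib.MeasureTheory.Integral.IntegralEqImproper
import Mathlib.MeasureTheory.Measure.Haar.NormedSpace
import Mathlib.Analysis.SpecialFunctions.Sqrt
import HarnessLib

/-!
# The integrals `∫_ℝ dx / (w + x²)²` and `∫_ℝ dx / (w + x²)³`

Mathlib-only leaf file (folklore calculus), companion of `InvSqAddSqIntegral.lean`
(`∫ dx/(a² + x²) = π/|a|`): for `w > 0`,

* `∫_ℝ ((w + x²)²)⁻¹ dx = π √w / (2 w²)`   (`integral_univ_inv_add_sq_sq`),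
* `∫_ℝ ((w + x²)³)⁻¹ dx = 3 π √w / (8 w³)` (`integral_univ_inv_add_sq_cube`),

together with the integrability of `x ↦ ((w + x²)ⁿ)⁻¹` (`1 ≤ n`), the `w = 1` values `π/2`, `3π/8`
(fundamental theorem of calculus on `ℝ` with the antiderivatives
`(x/(1+x²) + arctan x)/2` and `(x/(1+x²)² + 3 (x/(1+x²) + arctan x)/2)/4`), the scaling law
`∫ ((w + x²)ⁿ)⁻¹ = (√w / wⁿ) ∫ ((1 + x²)ⁿ)⁻¹` (substitution `x = √w y`), and the completed-square
form `∫_ℝ ((A (x - a₀)² + D)²)⁻¹ dx = π √(D/A) / (2 D²)` (`A, D > 0`).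

These are the one-dimensional inputs of the trace-form volume of `U(2)`
(`Literature/NumberTheory/Weil1964/`, total mass of the Cayley weight on `𝔲(2)`).

## References

* Folklore; e.g. [GradshteynRyzhik2015] I. S. Gradshteyn, I. M. Ryzhik, *Table of Integrals,
  Series, and Products*, 8th ed. (2015),
  3.249.1 / 2.148.4 (reduction formula for `∫ dx/(a + x²)ⁿ`).
-/

noncomputable section

open Real MeasureTheory Filter Topology

namespace Literature.Analysis.SpecialFunctions

/-! ## Integrability -/

/-- `x ↦ ((1 + x²)ⁿ)⁻¹` is integrable on `ℝ` for `1 ≤ n`. [cite: GradshteynRyzhik2015, 2.148.4] -/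
theorem integrable_inv_one_add_sq_pow {n : ℕ} (hn : 1 ≤ n) :
    Integrable fun x : ℝ => ((1 + x ^ 2) ^ n)⁻¹ := by
  refine integrable_inv_one_add_sq.mono' ?_ (ae_of_all _ fun x => ?_)
  · exact (by fun_prop (disch := intros; positivity) :
      Continuous fun x : ℝ => ((1 + x ^ 2) ^ n)⁻¹).aestronglyMeasurable
  · have h1 : (1 : ℝ) ≤ 1 + x ^ 2 := by nlinarith [sq_nonneg x]
    rw [Real.norm_eq_abs, abs_of_nonneg (by positivity)]
    exact inv_anti₀ (by positivity) (by simpa using pow_le_pow_right₀ h1 hn)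

/-- Pointwise identity behind the substitution `x = √w y`:
`((w + x²)ⁿ)⁻¹ = (wⁿ)⁻¹ ((1 + ((√w)⁻¹ x)²)ⁿ)⁻¹` for `w > 0`. [cite: GradshteynRyzhik2015, 2.148.4] -/
theorem inv_add_sq_pow_eq {w : ℝ} (hw : 0 < w) (n : ℕ) (x : ℝ) :
    ((w + x ^ 2) ^ n)⁻¹ = (w ^ n)⁻¹ * ((1 + ((√w)⁻¹ * x) ^ 2) ^ n)⁻¹ := by
  have hs : 0 < √w := Real.sqrt_pos.mpr hw
  have h1 : 1 + ((√w)⁻¹ * x) ^ 2 = w⁻¹ * (w + x ^ 2) := by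
    rw [mul_pow, inv_pow, Real.sq_sqrt hw.le]
    field_simp
  rw [h1, mul_pow, mul_inv, inv_pow, inv_inv, ← mul_assoc, inv_mul_cancel₀ (by positivity),
    one_mul]

/-- `x ↦ ((w + x²)ⁿ)⁻¹` is integrable on `ℝ` for `w > 0`, `1 ≤ n`. [cite: GradshteynRyzhik2015, 2.148.4] -/
theorem integrable_inv_add_sq_pow {w : ℝ} (hw : 0 < w) {n : ℕ} (hn : 1 ≤ n) :
    Integrable fun x : ℝ => ((w + x ^ 2) ^ n)⁻¹ := by
  have hs : (√w)⁻¹ ≠ 0 := inv_ne_zero (Real.sqrt_pos.mpr hw).ne'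
  simp_rw [inv_add_sq_pow_eq hw]
  exact ((integrable_inv_one_add_sq_pow hn).comp_mul_left' hs).const_mul _

/-! ## The values at `w = 1` -/

/-- `d/dx (x/(1+x²)) = (1 - x²)/(1+x²)²`. [cite: GradshteynRyzhik2015, 2.148.4] -/
theorem hasDerivAt_div_one_add_sq (x : ℝ) :
    HasDerivAt (fun x : ℝ => x / (1 + x ^ 2)) ((1 - x ^ 2) / (1 + x ^ 2) ^ 2) x := by
  have h : HasDerivAt (fun x : ℝ => 1 + x ^ 2) (2 * x) x := by
    simpa using (hasDerivAt_pow 2 x).const_add 1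
  have hx : 1 + x ^ 2 ≠ 0 := by positivity
  refine ((hasDerivAt_id' x).fun_div h hx).congr_deriv ?_
  field_simp
  ring

/-- `d/dx (x/(1+x²)²) = (1 - 3x²)/(1+x²)³`. [cite: GradshteynRyzhik2015, 2.148.4] -/
theorem hasDerivAt_div_one_add_sq_sq (x : ℝ) :
    HasDerivAt (fun x : ℝ => x / (1 + x ^ 2) ^ 2) ((1 - 3 * x ^ 2) / (1 + x ^ 2) ^ 3) x := by
  have h1 : HasDerivAt (fun x : ℝ => 1 + x ^ 2) (2 * x) x := by
    simpa using (hasDerivAt_pow 2 x).const_add 1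
  have h : HasDerivAt (fun x : ℝ => (1 + x ^ 2) ^ 2) (((2 : ℕ) : ℝ) * (1 + x ^ 2) ^ (2 - 1) * (2 * x)) x :=
    h1.fun_pow 2
  have hx : (1 + x ^ 2) ^ 2 ≠ 0 := by positivity
  have hx' : 1 + x ^ 2 ≠ 0 := by positivity
  refine ((hasDerivAt_id' x).fun_div h hx).congr_deriv ?_
  push_cast
  field_simp
  ring

/-- `|x/(1+x²)| ≤ |x⁻¹|`. [cite: GradshteynRyzhik2015, 2.148.4] -/
theorem norm_div_one_add_sq_le (x : ℝ) : ‖x / (1 + x ^ 2)‖ ≤ ‖x⁻¹‖ := by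
  rcases eq_or_ne x 0 with rfl | hx
  · simp
  have ha : 0 < |x| := abs_pos.mpr hx
  rw [Real.norm_eq_abs, Real.norm_eq_abs, abs_div, abs_inv,
    abs_of_pos (by positivity : (0 : ℝ) < 1 + x ^ 2), div_le_iff₀ (by positivity),
    inv_mul_eq_div, le_div_iff₀ ha, ← sq_abs]
  nlinarith

/-- `|x/(1+x²)²| ≤ |x⁻¹|`. [cite: GradshteynRyzhik2015, 2.148.4] -/
theorem norm_div_one_add_sq_sq_le (x : ℝ) : ‖x / (1 + x ^ 2) ^ 2‖ ≤ ‖x⁻¹‖ := by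
  refine le_trans ?_ (norm_div_one_add_sq_le x)
  rw [Real.norm_eq_abs, Real.norm_eq_abs, abs_div, abs_div,
    abs_of_pos (by positivity : (0 : ℝ) < (1 + x ^ 2) ^ 2),
    abs_of_pos (by positivity : (0 : ℝ) < 1 + x ^ 2)]
  refine div_le_div_of_nonneg_left (abs_nonneg x) (by positivity) ?_
  nlinarith [sq_nonneg x]

/-- `x/(1+x²) → 0` as `x → +∞`. [cite: GradshteynRyzhik2015, 2.148.4] -/
theorem tendsto_div_one_add_sq_atTop :
    Tendsto (fun x : ℝ => x / (1 + x ^ 2)) atTop (𝓝 0) :=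
  squeeze_zero_norm (fun x => norm_div_one_add_sq_le x)
    (tendsto_zero_iff_norm_tendsto_zero.mp tendsto_inv_atTop_zero)

/-- `x/(1+x²) → 0` as `x → -∞`. [cite: GradshteynRyzhik2015, 2.148.4] -/
theorem tendsto_div_one_add_sq_atBot :
    Tendsto (fun x : ℝ => x / (1 + x ^ 2)) atBot (𝓝 0) :=
  squeeze_zero_norm (fun x => norm_div_one_add_sq_le x)
    (tendsto_zero_iff_norm_tendsto_zero.mp tendsto_inv_atBot_zero)

/-- `x/(1+x²)² → 0` as `x → +∞`. [cite: GradshteynRyzhik2015, 2.148.4] -/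
theorem tendsto_div_one_add_sq_sq_atTop :
    Tendsto (fun x : ℝ => x / (1 + x ^ 2) ^ 2) atTop (𝓝 0) :=
  squeeze_zero_norm (fun x => norm_div_one_add_sq_sq_le x)
    (tendsto_zero_iff_norm_tendsto_zero.mp tendsto_inv_atTop_zero)

/-- `x/(1+x²)² → 0` as `x → -∞`. [cite: GradshteynRyzhik2015, 2.148.4] -/
theorem tendsto_div_one_add_sq_sq_atBot :
    Tendsto (fun x : ℝ => x / (1 + x ^ 2) ^ 2) atBot (𝓝 0) :=
  squeeze_zero_norm (fun x => norm_div_one_add_sq_sq_le x)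
    (tendsto_zero_iff_norm_tendsto_zero.mp tendsto_inv_atBot_zero)

/-- `∫_ℝ dx/(1+x²)² = π/2`. [cite: GradshteynRyzhik2015, 3.249.1] -/
theorem integral_univ_inv_one_add_sq_sq : ∫ x : ℝ, ((1 + x ^ 2) ^ 2)⁻¹ = π / 2 := by
  have hderiv : ∀ x : ℝ,
      HasDerivAt (fun x => (x / (1 + x ^ 2) + arctan x) / 2) (((1 + x ^ 2) ^ 2)⁻¹) x := by
    intro x
    have hx : 1 + x ^ 2 ≠ 0 := by positivity
    refine (((hasDerivAt_div_one_add_sq x).add (hasDerivAt_arctan' x)).div_const 2).congr_deriv ?_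
    field_simp
    ring
  rw [integral_of_hasDerivAt_of_tendsto hderiv (integrable_inv_one_add_sq_pow one_le_two)
    ((tendsto_div_one_add_sq_atBot.add
      (tendsto_nhds_of_tendsto_nhdsWithin tendsto_arctan_atBot)).div_const 2)
    ((tendsto_div_one_add_sq_atTop.add
      (tendsto_nhds_of_tendsto_nhdsWithin tendsto_arctan_atTop)).div_const 2)]
  ring

/-- `∫_ℝ dx/(1+x²)³ = 3π/8`. [cite: GradshteynRyzhik2015, 3.249.1] -/
theorem integral_univ_inv_one_add_sq_cube : ∫ x : ℝ, ((1 + x ^ 2) ^ 3)⁻¹ = 3 * π / 8 := by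
  have hderiv : ∀ x : ℝ,
      HasDerivAt (fun x => (x / (1 + x ^ 2) ^ 2 + 3 * ((x / (1 + x ^ 2) + arctan x) / 2)) / 4)
        (((1 + x ^ 2) ^ 3)⁻¹) x := by
    intro x
    have hx : 1 + x ^ 2 ≠ 0 := by positivity
    have hA := hasDerivAt_div_one_add_sq_sq x
    have hB : HasDerivAt (fun x => 3 * ((x / (1 + x ^ 2) + arctan x) / 2))
        (3 * (((1 - x ^ 2) / (1 + x ^ 2) ^ 2 + (1 + x ^ 2)⁻¹) / 2)) x :=
      (((hasDerivAt_div_one_add_sq x).add (hasDerivAt_arctan' x)).div_const 2).const_mul 3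
    refine ((hA.add hB).div_const 4).congr_deriv ?_
    field_simp
    ring
  have h3 : (1 : ℕ) ≤ 3 := by norm_num
  have lB : Tendsto (fun x : ℝ => 3 * ((x / (1 + x ^ 2) + arctan x) / 2)) atBot
      (𝓝 (3 * ((0 + -(π / 2)) / 2))) :=
    ((tendsto_div_one_add_sq_atBot.add
      (tendsto_nhds_of_tendsto_nhdsWithin tendsto_arctan_atBot)).div_const 2).const_mul 3
  have lT : Tendsto (fun x : ℝ => 3 * ((x / (1 + x ^ 2) + arctan x) / 2)) atTop
      (𝓝 (3 * ((0 + π / 2) / 2))) :=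
    ((tendsto_div_one_add_sq_atTop.add
      (tendsto_nhds_of_tendsto_nhdsWithin tendsto_arctan_atTop)).div_const 2).const_mul 3
  rw [integral_of_hasDerivAt_of_tendsto hderiv (integrable_inv_one_add_sq_pow h3)
    ((tendsto_div_one_add_sq_sq_atBot.add lB).div_const 4)
    ((tendsto_div_one_add_sq_sq_atTop.add lT).div_const 4)]
  ring

/-! ## Scaling to `w > 0` -/

/-- Substitution `x = √w y`: `∫ ((w + x²)ⁿ)⁻¹ = (√w / wⁿ) ∫ ((1 + y²)ⁿ)⁻¹` for `w > 0`.
[cite: GradshteynRyzhik2015, 2.148.4] -/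
theorem integral_univ_inv_add_sq_pow {w : ℝ} (hw : 0 < w) (n : ℕ) :
    ∫ x : ℝ, ((w + x ^ 2) ^ n)⁻¹ = √w / w ^ n * ∫ x : ℝ, ((1 + x ^ 2) ^ n)⁻¹ := by
  have hs : 0 < √w := Real.sqrt_pos.mpr hw
  simp_rw [inv_add_sq_pow_eq hw n]
  rw [integral_const_mul,
    Measure.integral_comp_mul_left (fun y : ℝ => ((1 + y ^ 2) ^ n)⁻¹) (√w)⁻¹,
    inv_inv, abs_of_pos hs, smul_eq_mul]
  ring

/-- `∫_ℝ dx/(w+x²)² = π √w/(2w²)` for `w > 0`. [cite: GradshteynRyzhik2015, 3.249.1] -/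
theorem integral_univ_inv_add_sq_sq {w : ℝ} (hw : 0 < w) :
    ∫ x : ℝ, ((w + x ^ 2) ^ 2)⁻¹ = π * √w / (2 * w ^ 2) := by
  rw [integral_univ_inv_add_sq_pow hw 2, integral_univ_inv_one_add_sq_sq]
  ring

/-- `∫_ℝ dx/(w+x²)³ = 3π √w/(8w³)` for `w > 0`. [cite: GradshteynRyzhik2015, 3.249.1] -/
theorem integral_univ_inv_add_sq_cube {w : ℝ} (hw : 0 < w) :
    ∫ x : ℝ, ((w + x ^ 2) ^ 3)⁻¹ = 3 * π * √w / (8 * w ^ 3) := by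
  rw [integral_univ_inv_add_sq_pow hw 3, integral_univ_inv_one_add_sq_cube]
  ring

/-! ## Completed square -/

/-- `x ↦ ((A (x - a₀)² + D)²)⁻¹` is integrable on `ℝ` for `A, D > 0`. [cite: GradshteynRyzhik2015, 2.148.4] -/
theorem integrable_inv_quadratic_sq {A D : ℝ} (hA : 0 < A) (hD : 0 < D) (a₀ : ℝ) :
    Integrable fun x : ℝ => ((A * (x - a₀) ^ 2 + D) ^ 2)⁻¹ := by
  have key : ∀ y : ℝ, ((A * y ^ 2 + D) ^ 2)⁻¹ = (A ^ 2)⁻¹ * ((D / A + y ^ 2) ^ 2)⁻¹ := by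
    intro y
    rw [← mul_inv, ← mul_pow]
    congr 2
    field_simp
    ring
  have h : Integrable fun y : ℝ => ((A * y ^ 2 + D) ^ 2)⁻¹ := by
    simp_rw [key]
    exact (integrable_inv_add_sq_pow (div_pos hD hA) one_le_two).const_mul _
  exact h.comp_sub_right a₀

/-- `∫_ℝ dx/(A (x - a₀)² + D)² = π √(D/A)/(2D²)` for `A, D > 0`. [cite: GradshteynRyzhik2015, 2.148.4] -/
theorem integral_univ_inv_quadratic_sq {A D : ℝ} (hA : 0 < A) (hD : 0 < D) (a₀ : ℝ) :
    ∫ x : ℝ, ((A * (x - a₀) ^ 2 + D) ^ 2)⁻¹ = π * √(D / A) / (2 * D ^ 2) := by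
  have key : ∀ y : ℝ, ((A * y ^ 2 + D) ^ 2)⁻¹ = (A ^ 2)⁻¹ * ((D / A + y ^ 2) ^ 2)⁻¹ := by
    intro y
    rw [← mul_inv, ← mul_pow]
    congr 2
    field_simp
    ring
  rw [integral_sub_right_eq_self (fun y : ℝ => ((A * y ^ 2 + D) ^ 2)⁻¹) a₀]
  simp_rw [key]
  rw [integral_const_mul, integral_univ_inv_add_sq_sq (div_pos hD hA)]
  field_simp

end Literature.Analysis.SpecialFunctions
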